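import Summits.BirchSwinnertonDyer.BirchSwinnertonDyer.Theorems.ByReductionTypeAtTwoRankOneAtTwoBigImageOddLocalOneDoorHalvesJoint
import Summits.BirchSwinnertonDyer.BirchSwinnertonDyer.Theorems.ByReductionTypeAtTwoRankOneAtTwoBigImageOddLocalOneDoorHalvesJointDoor
import HarnessLib

/-!
# Route ByReductionTypeAtTwo, crux `RankOneAtTwoBigImageOddLocal` (stmt-BirchSwinnertonDyer-23715), LINE v8.6 `one_door_analytic`:
# modulo the two halves U ∧ L, `BSD₂` of a slice curve ⟺ `BSD₂` of any one of its rank-`0` door twins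

Width prover seat `bsd-line-fkl-p2` g9 (2026-08-28), `--supports stmt-BirchSwinnertonDyer-23715`.  THEOREMS ONLY; nothing is asserted;
BSD is not proved by any of this.  Sequel of `…OneDoorHalvesJoint.lean` (§1b `bsdp_iff_twin_of_jointUpper_of_jointLower`: joint upper ∧ joint
lower say `def(W) + def(Wd) = 0`, so `BSD_p(W) ⟺ BSD_p(Wd)`) and `…OneDoorHalvesJointDoor.lean` (§2: U / L at a door datum ARE the joint halves).

* `bsdp_two_iff_twin_of_halves_at` — for `W` on the slice and any door datum: U → L → PRINT → (`BSDp W 2 ↔ BSDp Wd 2`).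
* `rankOneAtTwoBigImageOddLocal_bsdp_of_halves_of_oneTwin` — `BSD(W,2)` from U ∧ L ∧ «`BSD₂` of ONE globally minimal rank-`0` door twin of
  `W`» (the four primary facts supply the rest).

Reading for the pen: under U ∧ L the route's rank-`0` cruxes 19095–19098, restricted to the Hoffstein–Luo door twins of slice curves, are
not an independent input of the assembly but EQUIVALENT to the crux twin by twin; v1's assembly (p628086) already uses exactly one twin per
curve, and nothing weaker than `BSD₂` of that one twin can replace it (given U ∧ L it is also necessary).

References: [GrossLMS1991] §2 Conj. (2.2); [HoffsteinLuo1997] Theorem §1; [Milne1972ArithmeticAV] §1 Thm. 1; [Miller2011LMS] §1, Def. 1.1.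
-/

set_option autoImplicit false
-- the Theorems namespace of this sub repeats the summit name by design (D-0017 nested layout)
set_option linter.dupNamespace false

noncomputable section

open scoped Classical

namespace Summit.BirchSwinnertonDyer.BirchSwinnertonDyer.Theorems.RankOneAtTwoOneDoor

open WeierstrassCurve NumberField Literature.NumberTheory.EllipticCurves Literature.NumberTheory.EllipticCurves.ModularForms
  Literature.NumberTheory.EllipticCurves.Rank1Residual
  Literature.NumberTheory.EllipticCurves.Rank1Residual.Typed
  Literature.NumberTheory.EllipticCurves.KrizLi2019
  Summit.BirchSwinnertonDyer.Rank1Residual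
  Summit.BirchSwinnertonDyer.Rank1Residual.AdditivePotMult
  Summit.BirchSwinnertonDyer.Rank1Residual.F1Sign2
  Summit.BirchSwinnertonDyer.Rank1Residual.F1Sign2.TranspositionDoor
  Summit.BirchSwinnertonDyer.BirchSwinnertonDyer.Theses.ByReductionTypeAtTwo
  Summit.BirchSwinnertonDyer.BirchSwinnertonDyer.Theorems.CMExactDescent
  Summit.BirchSwinnertonDyer.BirchSwinnertonDyer.Theorems.SchneiderFree.Upper

/-! ### §12 On the slice: modulo U ∧ L, `BSD₂(W) ⟺ BSD₂(Wd)` at every door datum — the rank-`0` input as an EQUIVALENCE -/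

/-- **Modulo the two named halves U ∧ L and PRINT, the `2`-part of BSD of a slice curve is EQUIVALENT to the `2`-part of BSD of ANY ONE of
its rank-`0` door twins.**  For `W` on the slice (non-CM, `ρ_{W,2^n}` onto, odd torsion, odd Tamagawa, analytic rank `1`), a door-admissible
`K` with `L(W^{(d_K)},1) ≠ 0`, any datum, Heegner point and globally minimal twin `Wd`: U and L at this datum are the joint halves of the pair
(`…OneDoorHalvesJointDoor.lean` §2), i.e. `def(W) + def(Wd) = 0`, so `BSD(W,2) ↔ BSD(Wd,2)` (`bsdp_iff_twin_of_jointUpper_of_jointLower`).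
Reading for the pen: under U ∧ L the route's rank-`0` cruxes, restricted to the Hoffstein–Luo door twins of slice curves, are not an extra
INPUT but the SAME statement as the crux, twin by twin; one twin per slice curve suffices (v1's assembly p628086 uses exactly one).
Conditional on U, L by design; BSD is not proved by this. [cite: GrossLMS1991, §2 Conj. (2.2)] [cite: Miller2011LMS, Def. 1.1] -/
theorem bsdp_two_iff_twin_of_halves_at
    (hGZK : rank_eq_analyticRank_of_analyticRank_le_one) (hnf : exists_isNewformOf)
    (hU : DoorIndexLawUpperCAtTwo) (hL : DoorIndexLawLowerCAtTwo)
    (W : WeierstrassCurve ℚ) [W.IsElliptic] [W.IsGloballyMinimal] [NeZero (W.conductorNorm ℤ)]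
    (hCM : ¬ W.HasCM) (hsurj : ∀ n : ℕ, W.HasSurjectiveModNGaloisRep ((2 ^ n : ℕ) : ℤ)) (hT : Odd W.torsionOrder)
    (hc : Odd W.tamagawaProduct) (hr : W.analyticRank = 1)
    (K : Type) [Field K] [NumberField K] (hK : IsImaginaryQuadratic K)
    (hGZ : gross_zagier (W.conductorNorm ℤ) W K) (hKo : kolyvagin (W.conductorNorm ℤ) W K)
    (hadm : DoorAdmissible W (NumberField.discr K))
    (hLt : (W.quadraticTwist (NumberField.discr K : ℚ)).entireLFunction 1 ≠ 0)
    (Dt : ModularParametrizationData W (W.conductorNorm ℤ))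
    (H : HeegnerDatum (W.conductorNorm ℤ) (NumberField.discr K)) (ι : K →+* ℂ)
    (P : (W.baseChange K).toAffine.Point)
    (hP : WeierstrassCurve.Affine.Point.map ι.toRatAlgHom P = heegnerPointComplex Dt H)
    (Wd : WeierstrassCurve ℚ) [Wd.IsElliptic] [Wd.IsGloballyMinimal] (Cd : VariableChange ℚ)
    (hWd : Cd • W.quadraticTwist (NumberField.discr K : ℚ) = Wd) :
    BSDp W 2 ↔ BSDp Wd 2 := by
  haveI : Fact (Nat.Prime 2) := ⟨Nat.prime_two⟩
  obtain ⟨-, -, hrd, -⟩ := doorPairLedger_package_at W hT hc hr K hK hGZ hKo hadm hLt Dt H ι P hP Wd Cd hWd hnf hGZK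
  have hJU : JointUpperBoundAt W Wd 2 :=
    (jointUpperBoundAt_two_iff_doorLawGeC_at W hT hc hr K hK hGZ hKo hadm hLt Dt H ι P hP Wd Cd hWd hnf hGZK).mpr
      (hU W hCM hsurj hT hc hr K hK hadm hLt Dt H ι P hP Wd Cd hWd)
  have hJL : JointLowerBoundAt W Wd 2 :=
    (jointLowerBoundAt_two_iff_doorLawLeC_at W hT hc hr K hK hGZ hKo hadm hLt Dt H ι P hP Wd Cd hWd hnf hGZK).mpr
      (hL W hCM hsurj hT hc hr K hK hadm hLt Dt H ι P hP Wd Cd hWd)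
  exact bsdp_iff_twin_of_jointUpper_of_jointLower hGZK hr.le (by rw [hrd]; exact zero_le_one) hJU hJL

/-- **On the whole slice, modulo U ∧ L and the four primary facts: `BSD₂(W)` holds iff `BSD₂` holds for SOME globally minimal rank-`0` door
twin of `W`** (Hoffstein–Luo supplies a door; the iff at that door is `bsdp_two_iff_twin_of_halves_at`).  So the crux ⟸ U ∧ L ∧ «BSD₂ of ONE
door twin per slice curve», and conversely the crux ∧ U ∧ L ⟹ BSD₂ of EVERY door twin of every slice curve.  Conditional by design.
[cite: GrossLMS1991, §2 Conj. (2.2)] [cite: HoffsteinLuo1997, Theorem (§1, pp. 435–436)] [cite: Miller2011LMS, Def. 1.1] -/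
theorem rankOneAtTwoBigImageOddLocal_bsdp_of_halves_of_oneTwin
    (hGZ : ∀ (N : ℕ) [NeZero N] (W : WeierstrassCurve ℚ) (K : Type) [Field K] [NumberField K], gross_zagier N W K)
    (hKo : ∀ (N : ℕ) [NeZero N] (W : WeierstrassCurve ℚ) (K : Type) [Field K] [NumberField K], kolyvagin N W K)
    (hGZK : rank_eq_analyticRank_of_analyticRank_le_one) (hnf : exists_isNewformOf)
    (hU : DoorIndexLawUpperCAtTwo) (hL : DoorIndexLawLowerCAtTwo)
    (W : WeierstrassCurve ℚ) [W.IsElliptic] [W.IsGloballyMinimal] [NeZero (W.conductorNorm ℤ)]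
    (hCM : ¬ W.HasCM) (hsurj : ∀ n : ℕ, W.HasSurjectiveModNGaloisRep ((2 ^ n : ℕ) : ℤ)) (hT : Odd W.torsionOrder)
    (hc : Odd W.tamagawaProduct) (hr : W.analyticRank = 1)
    (htwin : ∃ (K : Type) (_ : Field K) (_ : NumberField K), IsImaginaryQuadratic K ∧ DoorAdmissible W (NumberField.discr K) ∧
      (W.quadraticTwist (NumberField.discr K : ℚ)).entireLFunction 1 ≠ 0 ∧
      ∃ (Wd : WeierstrassCurve ℚ) (_ : Wd.IsElliptic) (_ : Wd.IsGloballyMinimal) (Cd : VariableChange ℚ),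
        Cd • W.quadraticTwist (NumberField.discr K : ℚ) = Wd ∧ BSDp Wd 2) :
    BSDp W 2 := by
  obtain ⟨K, _iF, _iN, hK, hadm, hLt, Wd, _iE, _iM, Cd, hWd, hBd⟩ := htwin
  have hHN : SatisfiesHeegnerHypothesis (W.conductorNorm ℤ) K := satisfiesHeegnerHypothesis_of_doorAdmissible W K hK hadm
  obtain ⟨Dt⟩ := (nonempty_modularParametrizationData_iff_exists_isNewformOf_unconditional.mpr hnf) W
  obtain ⟨H, -⟩ :=
    nonempty_heegnerDatum_holds (W.conductorNorm ℤ) K hK (exists_dvd_sq_sub_discr_holds (W.conductorNorm ℤ) K hK hHN).choose_spec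
  obtain ⟨ι⟩ : Nonempty (K →+* ℂ) := inferInstance
  obtain ⟨P, hP⟩ := heegnerPointComplex_mem_range_map_holds (W.conductorNorm ℤ) W K hK hHN Dt H ι
  exact (bsdp_two_iff_twin_of_halves_at hGZK hnf hU hL W hCM hsurj hT hc hr K hK (hGZ _ W K) (hKo _ W K) hadm hLt Dt H ι P hP Wd Cd
    hWd).mpr hBd

end Summit.BirchSwinnertonDyer.BirchSwinnertonDyer.Theorems.RankOneAtTwoOneDoor

end
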